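import Literature.Geometry.Kaehler.ComplexTorusRationalFormsBasis
import Literature.AlgebraicGeometry.HodgeTheory.AbsoluteHodgeClasses
import HarnessLib

/-!
# The concrete Hodge classes of a complex torus map into the model layer (rational `(p,p)`-classes)

Layer `Literature/AlgebraicGeometry/HodgeTheory`; lane `lit-hodgefound`, Layer A4 (TRIBUNAL-A §4 /
TRACK 1(b): "a Layer-A row must name the concrete object beneath the model layer"). The concrete
objects are those of `Geometry/Kaehler/ComplexTorusHodgeClasses.lean`: for the complex torus
`X = E/Φ(ℤ^ι)`, `ComplexTorus.rationalForms Φ k = Hᵏ(X, ℚ)` and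
`ComplexTorus.hodgeClasses Φ p = H^{2p}(X, ℚ) ∩ H^{p,p}` inside `Alt^k_ℝ(E; ℂ)` (Lange 2023, §1.1.3–4,
§7.2.2). The MODEL layer of `AlgebraicGeometry/HodgeTheory` speaks of classes in singular cohomology
`Hᵏ(M; ℂ)` (`IsRationalClass`, `RationalHodgeClasses.lean`) and of the de Rham subspaces
`hodgePQ E M k p q = H^{p,q}(M)` (`ComplexForms.lean`), tied together by a natural complex de Rham
isomorphism family `e` (`ComplexDeRhamIsoFamily`, `DeRhamTheorem.lean`) which may be taken RATIONALLY
NORMALISED (`IsRationalDeRhamFamily e k`, `AbsoluteHodgeClasses.lean`; existence PROVED in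
`RationallyNormalisedDeRhamFamily.lean`: `exists_isRational_complexDeRhamIsoFamily_holds`).

This file records the two comparison maps, both immediate from tree theorems:

* `cconstClass_mem_hodgePQ_of_mem_hodgeClassesIn` — the de Rham class of a concrete Hodge class lies in
  `H^{p,p}(X)` (tree `ComplexTorus.cconstClass_mem_hodgePQ`, Lange 2023 Thm. 1.1.21; indeed
  `H^{p,q}(X) = cconstClass(Λ^{p,q})`, `ComplexTorus.hodgePQ_eq_map_typeSubmodule`);
* `isRationalClass_of_mem_rationalForms` — under a rationally normalised family `e`, the singular class
  `e[γ]` of a concrete rational class `γ ∈ Hᵏ(X, ℚ)` is a rational class (`IsRationalClass`), by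
  `ComplexTorus.mem_rationalForms_iff_forall_single` (rationality on lattice-basis tuples is exactly the
  hypothesis of `IsRationalDeRhamFamily`);
* `hodgeClasses_comparison` — both at once for `γ ∈ H^{2p}_Hodge(X)`: `e[γ]` is a rational class and
  `[γ] ∈ H^{p,p}(X)`; with `exists_isRational_complexDeRhamIsoFamily_holds` such an `e` (natural, normalised
  in all degrees) exists on every finite-dimensional `E`.

So every concrete Hodge class of Layer A is a Hodge class in the sense of the variety-level carriers
once `X` is a Hodge model of a smooth projective variety (the remaining step, `IsOfHodgeType` through
`HodgeModel`, is the business of `ComplexTorusWeightOneComparison` / `ComplexTorusLatticeCoordinatesHodge`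
and is not repeated here). No definition, no named fact.

## References

* [Lange2023AbelianVarietiesComplex] H. Lange, *Abelian Varieties over the Complex Numbers* (2023),
  §1.1.4 Prop. 1.1.20, §1.1.5 Thm. 1.1.21, §7.2.2.
* [BottTu1982Forms] R. Bott, L. Tu, *Differential Forms in Algebraic Topology* (1982), §I.5
  (de Rham theorem, periods).
-/

noncomputable section

open scoped Manifold ContDiff
open Literature.NumberTheory.Transcendental Literature.Geometry.Kaehler

namespace Literature.AlgebraicGeometry.HodgeTheory

section Comparison

variable {ι : Type} [Fintype ι] {E : Type} [NormedAddCommGroup E] [NormedSpace ℂ E]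
  (Φ : (ι → ℝ) ≃L[ℝ] E)

/-- **Concrete Hodge classes are of type `(p,p)` in de Rham cohomology**: for `γ ∈ hodgeClassesIn Φ k p`
(`k = 2p`) the class `[constForm γ] ∈ H^k_dR(X; ℂ)` lies in `H^{p,p}(X) = hodgePQ E X k p p`
(Lange 2023, Thm. 1.1.21: the invariant `(p,q)`-forms span `H^{p,q}`; tree
`ComplexTorus.cconstClass_mem_hodgePQ`). [cite: Lange2023AbelianVarietiesComplex, §1.1.5 Thm. 1.1.21] -/
theorem cconstClass_mem_hodgePQ_of_mem_hodgeClassesIn {k p : ℕ} (hk : p + p = k)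
    {γ : E [⋀^Fin k]→L[ℝ] ℂ} (hγ : γ ∈ ComplexTorus.hodgeClassesIn Φ k p) :
    ComplexTorus.cconstClass Φ γ ∈ hodgePQ E (ComplexTorus Φ) k p p :=
  ComplexTorus.cconstClass_mem_hodgePQ Φ
    ((ComplexTorus.isConstOfType_iff_isOfTypeAt γ).2
      ((ComplexTorus.mem_hodgeClassesIn_iff_isOfTypeAt Φ hk).1 hγ).2)

/-- The same for `hodgeClasses Φ p` (degree `2p`). [cite: Lange2023AbelianVarietiesComplex, §1.1.5 Thm. 1.1.21] -/
theorem cconstClass_mem_hodgePQ_of_mem_hodgeClasses {p : ℕ} {γ : E [⋀^Fin (2 * p)]→L[ℝ] ℂ}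
    (hγ : γ ∈ ComplexTorus.hodgeClasses Φ p) :
    ComplexTorus.cconstClass Φ γ ∈ hodgePQ E (ComplexTorus Φ) (2 * p) p p :=
  cconstClass_mem_hodgePQ_of_mem_hodgeClassesIn Φ (by omega) hγ

/-- **Concrete rational classes are rational classes in singular cohomology** under a rationally
normalised de Rham family: if `e` is rationally normalised in degree `k` (`IsRationalDeRhamFamily e k`:
constant forms with rational values on lattice-basis tuples have rational classes) and
`γ ∈ rationalForms Φ k = Hᵏ(X, ℚ)`, then `e[γ] ∈ Hᵏ(X; ℂ)` is a rational class. (By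
`ComplexTorus.mem_rationalForms_iff_forall_single`; Lange 2023, Prop. 1.1.20: the periods of the `dx_I`
over the lattice tori are `δ`.) [cite: Lange2023AbelianVarietiesComplex, §1.1.4 Prop. 1.1.20] -/
theorem isRationalClass_of_mem_rationalForms {e : ComplexDeRhamIsoFamily E} {k : ℕ}
    (he : IsRationalDeRhamFamily e k) {γ : E [⋀^Fin k]→L[ℝ] ℂ}
    (hγ : γ ∈ ComplexTorus.rationalForms Φ k) :
    IsRationalClass (e (ComplexTorus Φ) k (ComplexTorus.cconstClass Φ γ)) := by
  classical
  letI : LinearOrder ι := LinearOrder.lift' (Fintype.equivFin ι) (Fintype.equivFin ι).injective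
  exact he ι Φ γ ((ComplexTorus.mem_rationalForms_iff_forall_single Φ).1 hγ)

/-- **The comparison for Hodge classes**: under a rationally normalised family `e` (degree `2p`), a
concrete Hodge class `γ ∈ H^{2p}_Hodge(X)` has a RATIONAL singular class `e[γ]` whose de Rham class
lies in `H^{p,p}(X)` — i.e. it is a rational `(p,p)`-class of the torus in the sense of the model layer.
[cite: Lange2023AbelianVarietiesComplex, §7.2.2] -/
theorem hodgeClasses_comparison {e : ComplexDeRhamIsoFamily E} {p : ℕ}
    (he : IsRationalDeRhamFamily e (2 * p)) {γ : E [⋀^Fin (2 * p)]→L[ℝ] ℂ}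
    (hγ : γ ∈ ComplexTorus.hodgeClasses Φ p) :
    IsRationalClass (e (ComplexTorus Φ) (2 * p) (ComplexTorus.cconstClass Φ γ)) ∧
      ComplexTorus.cconstClass Φ γ ∈ hodgePQ E (ComplexTorus Φ) (2 * p) p p :=
  ⟨isRationalClass_of_mem_rationalForms Φ he (ComplexTorus.hodgeClasses_le_rationalForms Φ p hγ),
    cconstClass_mem_hodgePQ_of_mem_hodgeClasses Φ hγ⟩

end Comparison

end Literature.AlgebraicGeometry.HodgeTheory

end
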